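import Summits.ValiantsHypothesis.ValiantsHypothesis.Theorems.BarrierLeverPartitionMinorsChowMultiEdgeStep

/-!
# Route BarrierLever — Chow witnesses for partition minors (item 20172, CPM): ENGINE v6 — all the
# seat lineage's steps plus the GENERAL `m`-EDGE STEP («edge-locked for every `m`»)

Helper file (`--supports stmt-ValiantsHypothesis-20172`; cell valiant-natproofs, rung V4, 𝒟-side of
door (c); seat val-np-p4 gen 14).  Closes NO item.  Conventions of items 19717 / 20172 / 20195: a
layout `(u, w)` of height `h` is HIT when some product of `h + h` affine forms has nonsingular
partition minor `det[coeff_{E (u i) (w j)} ∏ ℓ]`.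

`chow_hit_of_multiEdgeCore` — engine v5 (`chow_hit_of_twoEdgeCore`, p549942) sharpened by
`multiEdgeStep_of_data` (file `…ChowMultiEdgeStep`): **a minimal layout missed by all products of
`h + h` affine forms is injective, locked, unpeelable, of size `r ≥ h + 1`, admits no leaf / edge /
double / two-edge step, and for NO `m ≥ 1` has a row coordinate `a` whose `a`-erasure is injective off
`m` tops `v l` (with bases `u (β l) = (u (v l)).erase a`) together with a column coordinate `c` of the
same kind with `m` tops** — in words: the row and column EDGE-COUNT profiles share no nonzero value.
The `m × m` base layout and the reduced layout are hit by the induction hypothesis itself (the base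
rows are not tops, so `m < r`), so the clause handed to the core prover is purely combinatorial.
Census (seat g13, kit j283701): beyond `m ≤ 2` the clause takes e.g. the `(0,0,3,3)` column-profile
classes of the `(4,7)` residue.  The proof is engine v5's induction verbatim with one more case.

WHAT THIS IS NOT: an organising principle (reduction), not a hit; nothing on items 20172 / 20195 /
19717 themselves, on crux stmt-ValiantsHypothesis-14610, or on `VP` versus `VNP`.
-/

set_option linter.dupNamespace false

namespace Summit.ValiantsHypothesis.ValiantsHypothesis.Theorems.BarrierLever.ChowFactor

open Finset MvPolynomial

noncomputable section

/-- **ENGINE WITH ALL STEPS INCLUDING THE GENERAL `m`-EDGE STEP (bounded form).** -/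
theorem chow_hit_of_multiEdgeCore_le
    (core : ∀ (h r : ℕ) (u w : Fin r → Finset (Fin h)), Function.Injective u → Function.Injective w →
      (∀ (a c : Fin h) (β γ : Bool),
        (Finset.univ.filter fun i => (a ∈ u i ↔ β = true)).card ≠
          (Finset.univ.filter fun j => (c ∈ w j ↔ γ = true)).card) →
      (∀ a c : Fin h, ¬ (Function.Injective (fun i => (u i).erase a) ∧
        Function.Injective (fun j => (w j).erase c))) →
      h + 1 ≤ r →
      (∀ (a c : Fin h) (i₁ j₁ j₀ : Fin r), (∀ i, i ≠ i₁ → (a ∈ u i ↔ a ∉ u i₁)) → j₁ ≠ j₀ →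
        w j₀ = (w j₁).erase c → ¬ Set.InjOn (fun j => (w j).erase c) {j | j ≠ j₁}) →
      (∀ (c a : Fin h) (j₁ i₁ i₀ : Fin r), (∀ j, j ≠ j₁ → (c ∈ w j ↔ c ∉ w j₁)) → i₁ ≠ i₀ →
        u i₀ = (u i₁).erase a → ¬ Set.InjOn (fun i => (u i).erase a) {i | i ≠ i₁}) →
      (∀ (a c : Fin h) (i₁ i₀ j₁ j₀ : Fin r), i₁ ≠ i₀ → u i₀ = (u i₁).erase a → j₁ ≠ j₀ →
        w j₀ = (w j₁).erase c → ¬ (Set.InjOn (fun i => (u i).erase a) {i | i ≠ i₁} ∧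
          Set.InjOn (fun j => (w j).erase c) {j | j ≠ j₁})) →
      (∀ (a a' c c' : Fin h) (i₀ v₁ v₂ j₀ j₀' j₁ j₂ : Fin r), a' ≠ a → c' ≠ c → v₁ ≠ i₀ → v₂ ≠ i₀ →
        v₂ ≠ v₁ → (a ∈ u v₁ ↔ a ∉ u i₀) → (a' ∈ u v₁ ↔ a' ∈ u i₀) → (a ∈ u v₂ ↔ a ∈ u i₀) →
        (a' ∈ u v₂ ↔ a' ∉ u i₀) → ((u v₁).erase a).erase a' = ((u i₀).erase a).erase a' →
        ((u v₂).erase a).erase a' = ((u i₀).erase a).erase a' →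
        j₀ ≠ j₁ → j₀' ≠ j₁ → j₀' ≠ j₂ → j₂ ≠ j₁ →
        ((w j₁).erase c).erase c' = ((w j₀).erase c).erase c' →
        ((w j₂).erase c).erase c' = ((w j₀').erase c).erase c' →
        ((if c ∈ w j₁ then (1 : ℂ) else 0) - (if c ∈ w j₀ then 1 else 0)) *
            ((if c' ∈ w j₂ then (1 : ℂ) else 0) - (if c' ∈ w j₀' then 1 else 0)) ≠
          ((if c ∈ w j₂ then (1 : ℂ) else 0) - (if c ∈ w j₀' then 1 else 0)) *
            ((if c' ∈ w j₁ then (1 : ℂ) else 0) - (if c' ∈ w j₀ then 1 else 0)) →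
        ¬ (Set.InjOn (fun i => ((u i).erase a).erase a') {i | i ≠ v₁ ∧ i ≠ v₂} ∧
          Set.InjOn (fun j => ((w j).erase c).erase c') {j | j ≠ j₁ ∧ j ≠ j₂})) →
      (∀ (c c' a a' : Fin h) (j₀ v₁ v₂ i₀ i₀' i₁ i₂ : Fin r), c' ≠ c → a' ≠ a → v₁ ≠ j₀ → v₂ ≠ j₀ →
        v₂ ≠ v₁ → (c ∈ w v₁ ↔ c ∉ w j₀) → (c' ∈ w v₁ ↔ c' ∈ w j₀) → (c ∈ w v₂ ↔ c ∈ w j₀) →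
        (c' ∈ w v₂ ↔ c' ∉ w j₀) → ((w v₁).erase c).erase c' = ((w j₀).erase c).erase c' →
        ((w v₂).erase c).erase c' = ((w j₀).erase c).erase c' →
        i₀ ≠ i₁ → i₀' ≠ i₁ → i₀' ≠ i₂ → i₂ ≠ i₁ →
        ((u i₁).erase a).erase a' = ((u i₀).erase a).erase a' →
        ((u i₂).erase a).erase a' = ((u i₀').erase a).erase a' →
        ((if a ∈ u i₁ then (1 : ℂ) else 0) - (if a ∈ u i₀ then 1 else 0)) *
            ((if a' ∈ u i₂ then (1 : ℂ) else 0) - (if a' ∈ u i₀' then 1 else 0)) ≠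
          ((if a ∈ u i₂ then (1 : ℂ) else 0) - (if a ∈ u i₀' then 1 else 0)) *
            ((if a' ∈ u i₁ then (1 : ℂ) else 0) - (if a' ∈ u i₀ then 1 else 0)) →
        ¬ (Set.InjOn (fun j => ((w j).erase c).erase c') {j | j ≠ v₁ ∧ j ≠ v₂} ∧
          Set.InjOn (fun i => ((u i).erase a).erase a') {i | i ≠ i₁ ∧ i ≠ i₂})) →
      (∀ (a c : Fin h) (v₀ v₀' v₁ v₂ j₀ j₀' j₁ j₂ : Fin r), v₂ ≠ v₁ → a ∈ u v₁ → a ∈ u v₂ →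
        u v₀ = (u v₁).erase a → u v₀' = (u v₂).erase a → j₂ ≠ j₁ → j₀ ≠ j₁ → j₀' ≠ j₁ → j₀' ≠ j₂ →
        c ∈ w j₁ → c ∈ w j₂ → w j₀ = (w j₁).erase c → w j₀' = (w j₂).erase c →
        ¬ (Set.InjOn (fun i => (u i).erase a) {i | i ≠ v₁ ∧ i ≠ v₂} ∧
          Set.InjOn (fun j => (w j).erase c) {j | j ≠ j₁ ∧ j ≠ j₂})) →
      (∀ (a c : Fin h) (m : ℕ) (v β j γ : Fin m → Fin r), 1 ≤ m → Function.Injective v →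
        Function.Injective j → (∀ l, a ∈ u (v l)) → (∀ l, u (β l) = (u (v l)).erase a) →
        (∀ l, c ∈ w (j l)) → (∀ l, w (γ l) = (w (j l)).erase c) →
        ¬ (Set.InjOn (fun i => (u i).erase a) {i | ∀ l, i ≠ v l} ∧
          Set.InjOn (fun j' => (w j').erase c) {j' | ∀ l, j' ≠ j l})) →
      ∃ ℓ : Fin (h + h) → MvPolynomial (Fin (h + h)) ℂ, (∀ q, (ℓ q).totalDegree ≤ 1) ∧
        (Matrix.of fun i j : Fin r => coeff
          (∑ b ∈ u i, Finsupp.single (Fin.castAdd h b) 1 + ∑ d ∈ w j, Finsupp.single (Fin.natAdd h d) 1)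
          (∏ q, ℓ q)).det ≠ 0)
    (R : ℕ) : ∀ (h r : ℕ), r ≤ R → ∀ (u w : Fin r → Finset (Fin h)), Function.Injective u →
      Function.Injective w →
      ∃ ℓ : Fin (h + h) → MvPolynomial (Fin (h + h)) ℂ, (∀ q, (ℓ q).totalDegree ≤ 1) ∧
        (Matrix.of fun i j : Fin r => coeff
          (∑ b ∈ u i, Finsupp.single (Fin.castAdd h b) 1 + ∑ d ∈ w j, Finsupp.single (Fin.natAdd h d) 1)
          (∏ q, ℓ q)).det ≠ 0 := by
  classical
  induction R with
  | zero =>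
    intro h r hr u w hu hw
    exact chowHits_of_size_le_three h r (by omega) u w hu hw
  | succ R ih =>
    intro h r hr u w hu hw
    rcases Nat.lt_or_ge r 4 with hr4 | hr4
    · exact chowHits_of_size_le_three h r (by omega) u w hu hw
    have hR2 : 2 ≤ R := by omega
    refine chow_hit_of_core_le (R + 1) ?_ h r hr u w hu hw
    intro h' r' u' w' hr' hu' hw' hlk hpl hsz
    -- edge step
    by_cases hedge : ∃ (a c : Fin h') (i₁ i₀ j₁ j₀ : Fin r'), i₁ ≠ i₀ ∧ u' i₀ = (u' i₁).erase a ∧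
        j₁ ≠ j₀ ∧ w' j₀ = (w' j₁).erase c ∧ Set.InjOn (fun i => (u' i).erase a) {i | i ≠ i₁} ∧
        Set.InjOn (fun j => (w' j).erase c) {j | j ≠ j₁}
    · obtain ⟨a, c, i₁, i₀, j₁, j₀, hi, hi₀, hj, hj₀, hinju, hinjw⟩ := hedge
      obtain ⟨h'', rfl⟩ : ∃ h'', h' = h'' + 1 := ⟨h' - 1, by have := a.pos; omega⟩
      obtain ⟨r'', rfl⟩ : ∃ r'', r' = r'' + 1 := ⟨r' - 1, by have := i₁.pos; omega⟩
      exact chow_edgeStep a c u' w' i₁ i₀ j₁ j₀ hi (mem_of_edge u' hu' hi hi₀) hi₀ hj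
        (mem_of_edge w' hw' hj hj₀) hj₀
        (ih h'' r'' (by omega) _ _ (preimage_succAbove_injective_of_injOn a u' i₁ hinju)
          (preimage_succAbove_injective_of_injOn c w' j₁ hinjw))
    -- leaf steps
    by_cases hrow : ∃ (a c : Fin h') (i₁ j₁ j₀ : Fin r'), (∀ i, i ≠ i₁ → (a ∈ u' i ↔ a ∉ u' i₁)) ∧
        j₁ ≠ j₀ ∧ w' j₀ = (w' j₁).erase c ∧ Set.InjOn (fun j => (w' j).erase c) {j | j ≠ j₁}
    · obtain ⟨a, c, i₁, j₁, j₀, hlone, hj, hj₀, hinj⟩ := hrow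
      obtain ⟨h'', rfl⟩ : ∃ h'', h' = h'' + 1 := ⟨h' - 1, by have := a.pos; omega⟩
      obtain ⟨r'', rfl⟩ : ∃ r'', r' = r'' + 1 := ⟨r' - 1, by have := i₁.pos; omega⟩
      exact chow_leafStep a c u' w' i₁ j₁ j₀ hlone hj (mem_of_edge w' hw' hj hj₀) hj₀
        (ih h'' r'' (by omega) _ _ (preimage_succAbove_injective_of_lonely a u' hu' i₁ hlone)
          (preimage_succAbove_injective_of_injOn c w' j₁ hinj))
    by_cases hcol : ∃ (c a : Fin h') (j₁ i₁ i₀ : Fin r'), (∀ j, j ≠ j₁ → (c ∈ w' j ↔ c ∉ w' j₁)) ∧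
        i₁ ≠ i₀ ∧ u' i₀ = (u' i₁).erase a ∧ Set.InjOn (fun i => (u' i).erase a) {i | i ≠ i₁}
    · obtain ⟨c, a, j₁, i₁, i₀, hlone, hi, hi₀, hinj⟩ := hcol
      obtain ⟨h'', rfl⟩ : ∃ h'', h' = h'' + 1 := ⟨h' - 1, by have := a.pos; omega⟩
      obtain ⟨r'', rfl⟩ : ∃ r'', r' = r'' + 1 := ⟨r' - 1, by have := i₁.pos; omega⟩
      refine chow_hit_swap u' w' ?_
      exact chow_leafStep c a w' u' j₁ i₁ i₀ hlone hi (mem_of_edge u' hu' hi hi₀) hi₀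
        (ih h'' r'' (by omega) _ _ (preimage_succAbove_injective_of_lonely c w' hw' j₁ hlone)
          (preimage_succAbove_injective_of_injOn a u' i₁ hinj))
    -- double steps
    by_cases hd : ∃ (a a' c c' : Fin h') (i₀ v₁ v₂ j₀ j₀' j₁ j₂ : Fin r'), a' ≠ a ∧ c' ≠ c ∧ v₁ ≠ i₀ ∧
        v₂ ≠ i₀ ∧ v₂ ≠ v₁ ∧ (a ∈ u' v₁ ↔ a ∉ u' i₀) ∧ (a' ∈ u' v₁ ↔ a' ∈ u' i₀) ∧
        (a ∈ u' v₂ ↔ a ∈ u' i₀) ∧ (a' ∈ u' v₂ ↔ a' ∉ u' i₀) ∧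
        ((u' v₁).erase a).erase a' = ((u' i₀).erase a).erase a' ∧
        ((u' v₂).erase a).erase a' = ((u' i₀).erase a).erase a' ∧
        j₀ ≠ j₁ ∧ j₀' ≠ j₁ ∧ j₀' ≠ j₂ ∧ j₂ ≠ j₁ ∧
        ((w' j₁).erase c).erase c' = ((w' j₀).erase c).erase c' ∧
        ((w' j₂).erase c).erase c' = ((w' j₀').erase c).erase c' ∧
        ((if c ∈ w' j₁ then (1 : ℂ) else 0) - (if c ∈ w' j₀ then 1 else 0)) *
            ((if c' ∈ w' j₂ then (1 : ℂ) else 0) - (if c' ∈ w' j₀' then 1 else 0)) ≠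
          ((if c ∈ w' j₂ then (1 : ℂ) else 0) - (if c ∈ w' j₀' then 1 else 0)) *
            ((if c' ∈ w' j₁ then (1 : ℂ) else 0) - (if c' ∈ w' j₀ then 1 else 0)) ∧
        Set.InjOn (fun i => ((u' i).erase a).erase a') {i | i ≠ v₁ ∧ i ≠ v₂} ∧
        Set.InjOn (fun j => ((w' j).erase c).erase c') {j | j ≠ j₁ ∧ j ≠ j₂}
    · obtain ⟨a, a', c, c', i₀, v₁, v₂, j₀, j₀', j₁, j₂, haa, hcc, hi₁, hi₂, h12, ha₁, ha'₁, ha₂, ha'₂,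
        hlab₁, hlab₂, hj₀, hj₀', hj₀'₂, hj12, hcol₁, hcol₂, hδ, hinju, hinjw⟩ := hd
      exact doubleStep_of_data ih u' w' (by omega) a a' c c' i₀ v₁ v₂ j₀ j₀' j₁ j₂ haa hcc hi₁ hi₂ h12
        ha₁ ha'₁ ha₂ ha'₂ hlab₁ hlab₂ hj₀ hj₀' hj₀'₂ hj12 hcol₁ hcol₂ hδ hinju hinjw
    by_cases hd' : ∃ (c c' a a' : Fin h') (j₀ v₁ v₂ i₀ i₀' i₁ i₂ : Fin r'), c' ≠ c ∧ a' ≠ a ∧ v₁ ≠ j₀ ∧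
        v₂ ≠ j₀ ∧ v₂ ≠ v₁ ∧ (c ∈ w' v₁ ↔ c ∉ w' j₀) ∧ (c' ∈ w' v₁ ↔ c' ∈ w' j₀) ∧
        (c ∈ w' v₂ ↔ c ∈ w' j₀) ∧ (c' ∈ w' v₂ ↔ c' ∉ w' j₀) ∧
        ((w' v₁).erase c).erase c' = ((w' j₀).erase c).erase c' ∧
        ((w' v₂).erase c).erase c' = ((w' j₀).erase c).erase c' ∧
        i₀ ≠ i₁ ∧ i₀' ≠ i₁ ∧ i₀' ≠ i₂ ∧ i₂ ≠ i₁ ∧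
        ((u' i₁).erase a).erase a' = ((u' i₀).erase a).erase a' ∧
        ((u' i₂).erase a).erase a' = ((u' i₀').erase a).erase a' ∧
        ((if a ∈ u' i₁ then (1 : ℂ) else 0) - (if a ∈ u' i₀ then 1 else 0)) *
            ((if a' ∈ u' i₂ then (1 : ℂ) else 0) - (if a' ∈ u' i₀' then 1 else 0)) ≠
          ((if a ∈ u' i₂ then (1 : ℂ) else 0) - (if a ∈ u' i₀' then 1 else 0)) *
            ((if a' ∈ u' i₁ then (1 : ℂ) else 0) - (if a' ∈ u' i₀ then 1 else 0)) ∧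
        Set.InjOn (fun j => ((w' j).erase c).erase c') {j | j ≠ v₁ ∧ j ≠ v₂} ∧
        Set.InjOn (fun i => ((u' i).erase a).erase a') {i | i ≠ i₁ ∧ i ≠ i₂}
    · obtain ⟨c, c', a, a', j₀, v₁, v₂, i₀, i₀', i₁, i₂, hcc, haa, hi₁, hi₂, h12, ha₁, ha'₁, ha₂, ha'₂,
        hlab₁, hlab₂, hj₀, hj₀', hj₀'₂, hj12, hcol₁, hcol₂, hδ, hinjw, hinju⟩ := hd'
      refine chow_hit_swap u' w' ?_
      exact doubleStep_of_data ih w' u' (by omega) c c' a a' j₀ v₁ v₂ i₀ i₀' i₁ i₂ hcc haa hi₁ hi₂ h12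
        ha₁ ha'₁ ha₂ ha'₂ hlab₁ hlab₂ hj₀ hj₀' hj₀'₂ hj12 hcol₁ hcol₂ hδ hinjw hinju
    -- two-edge step
    by_cases hte : ∃ (a c : Fin h') (v₀ v₀' v₁ v₂ j₀ j₀' j₁ j₂ : Fin r'), v₂ ≠ v₁ ∧ a ∈ u' v₁ ∧
        a ∈ u' v₂ ∧ u' v₀ = (u' v₁).erase a ∧ u' v₀' = (u' v₂).erase a ∧ j₂ ≠ j₁ ∧ j₀ ≠ j₁ ∧
        j₀' ≠ j₁ ∧ j₀' ≠ j₂ ∧ c ∈ w' j₁ ∧ c ∈ w' j₂ ∧ w' j₀ = (w' j₁).erase c ∧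
        w' j₀' = (w' j₂).erase c ∧ Set.InjOn (fun i => (u' i).erase a) {i | i ≠ v₁ ∧ i ≠ v₂} ∧
        Set.InjOn (fun j => (w' j).erase c) {j | j ≠ j₁ ∧ j ≠ j₂}
    · obtain ⟨a, c, v₀, v₀', v₁, v₂, j₀, j₀', j₁, j₂, h12, ha₁, ha₂, hv₀, hv₀', hj12, hj₀, hj₀', hj₀'₂,
        hc₁, hc₂, hw₀, hw₀', hinju, hinjw⟩ := hte
      exact twoEdgeStep_of_data ih hR2 u' w' hu' hw' (by omega) a c v₀ v₀' v₁ v₂ j₀ j₀' j₁ j₂ h12 ha₁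
        ha₂ hv₀ hv₀' hj12 hj₀ hj₀' hj₀'₂ hc₁ hc₂ hw₀ hw₀' hinju hinjw
    -- multi-edge step (every m ≥ 1)
    by_cases hme : ∃ (a c : Fin h') (m : ℕ) (v β j γ : Fin m → Fin r'), 1 ≤ m ∧
        Function.Injective v ∧ Function.Injective j ∧ (∀ l, a ∈ u' (v l)) ∧
        (∀ l, u' (β l) = (u' (v l)).erase a) ∧ (∀ l, c ∈ w' (j l)) ∧
        (∀ l, w' (γ l) = (w' (j l)).erase c) ∧
        Set.InjOn (fun i => (u' i).erase a) {i | ∀ l, i ≠ v l} ∧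
        Set.InjOn (fun j' => (w' j').erase c) {j' | ∀ l, j' ≠ j l}
    · obtain ⟨a, c, m, v, β, j, γ, hm1, hv, hj, ha, hβ, hc, hγ, hinju, hinjw⟩ := hme
      exact multiEdgeStep_of_data ih u' w' hu' hw' (by omega) a c hm1 v β j γ hv hj ha hβ hc hγ hinju hinjw
    -- no step available
    push Not at hedge hrow hcol hd hd' hte hme
    exact core h' r' u' w' hu' hw' hlk hpl hsz
      (fun a c i₁ j₁ j₀ hlone hj hj₀ => hrow a c i₁ j₁ j₀ hlone hj hj₀)
      (fun c a j₁ i₁ i₀ hlone hi hi₀ => hcol c a j₁ i₁ i₀ hlone hi hi₀)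
      (fun a c i₁ i₀ j₁ j₀ hi hi₀ hj hj₀ hboth => hedge a c i₁ i₀ j₁ j₀ hi hi₀ hj hj₀ hboth.1 hboth.2)
      (fun a a' c c' i₀ v₁ v₂ j₀ j₀' j₁ j₂ h1 h2 h3 h4 h5 h6 h7 h8 h9 h10 h11 h12 h13 h14 h15 h16 h17 h18
          hboth => hd a a' c c' i₀ v₁ v₂ j₀ j₀' j₁ j₂ h1 h2 h3 h4 h5 h6 h7 h8 h9 h10 h11 h12 h13 h14 h15 h16
          h17 h18 hboth.1 hboth.2)
      (fun c c' a a' j₀ v₁ v₂ i₀ i₀' i₁ i₂ h1 h2 h3 h4 h5 h6 h7 h8 h9 h10 h11 h12 h13 h14 h15 h16 h17 h18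
          hboth => hd' c c' a a' j₀ v₁ v₂ i₀ i₀' i₁ i₂ h1 h2 h3 h4 h5 h6 h7 h8 h9 h10 h11 h12 h13 h14 h15
          h16 h17 h18 hboth.1 hboth.2)
      (fun a c v₀ v₀' v₁ v₂ j₀ j₀' j₁ j₂ h1 h2 h3 h4 h5 h6 h7 h8 h9 h10 h11 h12' h13 hboth =>
        hte a c v₀ v₀' v₁ v₂ j₀ j₀' j₁ j₂ h1 h2 h3 h4 h5 h6 h7 h8 h9 h10 h11 h12' h13 hboth.1 hboth.2)
      (fun a c m v β j γ h1 h2 h3 h4 h5 h6 h7 hboth =>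
        hme a c m v β j γ h1 h2 h3 h4 h5 h6 h7 hboth.1 hboth.2)

/-- **ENGINE v6.**  If every injective layout that is locked, unpeelable, of size `r ≥ h + 1`, admits no
leaf step, no edge step, no double step (either side), no two-edge step AND — for every `m ≥ 1` — no row
coordinate whose `a`-edges have exactly the tops `v` against a column coordinate with exactly the
tops `j` (`m` of each: «EDGE-LOCKED for every `m`») is hit by a product of `h + h` affine forms, then
every injective layout is hit. -/
theorem chow_hit_of_multiEdgeCore
    (core : ∀ (h r : ℕ) (u w : Fin r → Finset (Fin h)), Function.Injective u → Function.Injective w →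
      (∀ (a c : Fin h) (β γ : Bool),
        (Finset.univ.filter fun i => (a ∈ u i ↔ β = true)).card ≠
          (Finset.univ.filter fun j => (c ∈ w j ↔ γ = true)).card) →
      (∀ a c : Fin h, ¬ (Function.Injective (fun i => (u i).erase a) ∧
        Function.Injective (fun j => (w j).erase c))) →
      h + 1 ≤ r →
      (∀ (a c : Fin h) (i₁ j₁ j₀ : Fin r), (∀ i, i ≠ i₁ → (a ∈ u i ↔ a ∉ u i₁)) → j₁ ≠ j₀ →
        w j₀ = (w j₁).erase c → ¬ Set.InjOn (fun j => (w j).erase c) {j | j ≠ j₁}) →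
      (∀ (c a : Fin h) (j₁ i₁ i₀ : Fin r), (∀ j, j ≠ j₁ → (c ∈ w j ↔ c ∉ w j₁)) → i₁ ≠ i₀ →
        u i₀ = (u i₁).erase a → ¬ Set.InjOn (fun i => (u i).erase a) {i | i ≠ i₁}) →
      (∀ (a c : Fin h) (i₁ i₀ j₁ j₀ : Fin r), i₁ ≠ i₀ → u i₀ = (u i₁).erase a → j₁ ≠ j₀ →
        w j₀ = (w j₁).erase c → ¬ (Set.InjOn (fun i => (u i).erase a) {i | i ≠ i₁} ∧
          Set.InjOn (fun j => (w j).erase c) {j | j ≠ j₁})) →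
      (∀ (a a' c c' : Fin h) (i₀ v₁ v₂ j₀ j₀' j₁ j₂ : Fin r), a' ≠ a → c' ≠ c → v₁ ≠ i₀ → v₂ ≠ i₀ →
        v₂ ≠ v₁ → (a ∈ u v₁ ↔ a ∉ u i₀) → (a' ∈ u v₁ ↔ a' ∈ u i₀) → (a ∈ u v₂ ↔ a ∈ u i₀) →
        (a' ∈ u v₂ ↔ a' ∉ u i₀) → ((u v₁).erase a).erase a' = ((u i₀).erase a).erase a' →
        ((u v₂).erase a).erase a' = ((u i₀).erase a).erase a' →
        j₀ ≠ j₁ → j₀' ≠ j₁ → j₀' ≠ j₂ → j₂ ≠ j₁ →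
        ((w j₁).erase c).erase c' = ((w j₀).erase c).erase c' →
        ((w j₂).erase c).erase c' = ((w j₀').erase c).erase c' →
        ((if c ∈ w j₁ then (1 : ℂ) else 0) - (if c ∈ w j₀ then 1 else 0)) *
            ((if c' ∈ w j₂ then (1 : ℂ) else 0) - (if c' ∈ w j₀' then 1 else 0)) ≠
          ((if c ∈ w j₂ then (1 : ℂ) else 0) - (if c ∈ w j₀' then 1 else 0)) *
            ((if c' ∈ w j₁ then (1 : ℂ) else 0) - (if c' ∈ w j₀ then 1 else 0)) →
        ¬ (Set.InjOn (fun i => ((u i).erase a).erase a') {i | i ≠ v₁ ∧ i ≠ v₂} ∧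
          Set.InjOn (fun j => ((w j).erase c).erase c') {j | j ≠ j₁ ∧ j ≠ j₂})) →
      (∀ (c c' a a' : Fin h) (j₀ v₁ v₂ i₀ i₀' i₁ i₂ : Fin r), c' ≠ c → a' ≠ a → v₁ ≠ j₀ → v₂ ≠ j₀ →
        v₂ ≠ v₁ → (c ∈ w v₁ ↔ c ∉ w j₀) → (c' ∈ w v₁ ↔ c' ∈ w j₀) → (c ∈ w v₂ ↔ c ∈ w j₀) →
        (c' ∈ w v₂ ↔ c' ∉ w j₀) → ((w v₁).erase c).erase c' = ((w j₀).erase c).erase c' →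
        ((w v₂).erase c).erase c' = ((w j₀).erase c).erase c' →
        i₀ ≠ i₁ → i₀' ≠ i₁ → i₀' ≠ i₂ → i₂ ≠ i₁ →
        ((u i₁).erase a).erase a' = ((u i₀).erase a).erase a' →
        ((u i₂).erase a).erase a' = ((u i₀').erase a).erase a' →
        ((if a ∈ u i₁ then (1 : ℂ) else 0) - (if a ∈ u i₀ then 1 else 0)) *
            ((if a' ∈ u i₂ then (1 : ℂ) else 0) - (if a' ∈ u i₀' then 1 else 0)) ≠
          ((if a ∈ u i₂ then (1 : ℂ) else 0) - (if a ∈ u i₀' then 1 else 0)) *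
            ((if a' ∈ u i₁ then (1 : ℂ) else 0) - (if a' ∈ u i₀ then 1 else 0)) →
        ¬ (Set.InjOn (fun j => ((w j).erase c).erase c') {j | j ≠ v₁ ∧ j ≠ v₂} ∧
          Set.InjOn (fun i => ((u i).erase a).erase a') {i | i ≠ i₁ ∧ i ≠ i₂})) →
      (∀ (a c : Fin h) (v₀ v₀' v₁ v₂ j₀ j₀' j₁ j₂ : Fin r), v₂ ≠ v₁ → a ∈ u v₁ → a ∈ u v₂ →
        u v₀ = (u v₁).erase a → u v₀' = (u v₂).erase a → j₂ ≠ j₁ → j₀ ≠ j₁ → j₀' ≠ j₁ → j₀' ≠ j₂ →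
        c ∈ w j₁ → c ∈ w j₂ → w j₀ = (w j₁).erase c → w j₀' = (w j₂).erase c →
        ¬ (Set.InjOn (fun i => (u i).erase a) {i | i ≠ v₁ ∧ i ≠ v₂} ∧
          Set.InjOn (fun j => (w j).erase c) {j | j ≠ j₁ ∧ j ≠ j₂})) →
      (∀ (a c : Fin h) (m : ℕ) (v β j γ : Fin m → Fin r), 1 ≤ m → Function.Injective v →
        Function.Injective j → (∀ l, a ∈ u (v l)) → (∀ l, u (β l) = (u (v l)).erase a) →
        (∀ l, c ∈ w (j l)) → (∀ l, w (γ l) = (w (j l)).erase c) →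
        ¬ (Set.InjOn (fun i => (u i).erase a) {i | ∀ l, i ≠ v l} ∧
          Set.InjOn (fun j' => (w j').erase c) {j' | ∀ l, j' ≠ j l})) →
      ∃ ℓ : Fin (h + h) → MvPolynomial (Fin (h + h)) ℂ, (∀ q, (ℓ q).totalDegree ≤ 1) ∧
        (Matrix.of fun i j : Fin r => coeff
          (∑ b ∈ u i, Finsupp.single (Fin.castAdd h b) 1 + ∑ d ∈ w j, Finsupp.single (Fin.natAdd h d) 1)
          (∏ q, ℓ q)).det ≠ 0)
    (h r : ℕ) (u w : Fin r → Finset (Fin h)) (hu : Function.Injective u)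
    (hw : Function.Injective w) :
    ∃ ℓ : Fin (h + h) → MvPolynomial (Fin (h + h)) ℂ, (∀ q, (ℓ q).totalDegree ≤ 1) ∧
      (Matrix.of fun i j : Fin r => coeff
        (∑ b ∈ u i, Finsupp.single (Fin.castAdd h b) 1 + ∑ d ∈ w j, Finsupp.single (Fin.natAdd h d) 1)
        (∏ q, ℓ q)).det ≠ 0 :=
  chow_hit_of_multiEdgeCore_le core r h r le_rfl u w hu hw

end

end Summit.ValiantsHypothesis.ValiantsHypothesis.Theorems.BarrierLever.ChowFactor
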